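/-
Copyright: lit-balaban cell (HOME `run/shared/lean/pub/lit-balaban/`), Phase-2 proof seat p12 (gen 10).  The proofs are
kernel-checked; nothing is claimed beyond what the kernel checks below.
-/
import Literature.MathematicalPhysics.QuantumFieldTheory.DybalskiStottmeisterTanimoto2024.DST24InftyBounds

/-!
# `DybalskiStottmeisterTanimoto2024.DST24KernelDecay` — [DybalskiStottmeisterTanimoto2024] **§4.4 Lemma (Green-function-Neumann)
# PROVED**: the kernels of the finite-volume Green function `G(Ω) = Γ = (−Δ_Ω + Q*Q)⁻¹` and of `(QG(Ω)Q*)⁻¹` decay exponentially,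
# «`|G(Ω)(x,x′)| ≤ Ce^{−C₁|x−x′|}`, `|(QG(Ω)Q*)⁻¹(y,y′)| ≤ Ce^{−C₁|y−y′|}` for some constants `C, C₁ > 0`, independent of `n`»

statement-level skeleton of published theorems with citation tags; proofs where landed; nothing here is a claim about
the Yang–Mills mass gap

W. Dybalski, A. Stottmeister, Y. Tanimoto, *The Bałaban variational problem in the non-linear sigma model*, Rev. Math. Phys.
**36** (2024), arXiv:2403.09800; source held `paper:arxiv-2403.09800` (§4.4 «Method of images», last lemma = tex chunk p0015:
«We immediately obtain from Lemmas (method-of-images-lemma-zero), (method-of-images-lemma), the exponential decay of kernels of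
the corresponding operators on a finite lattice. The following lemma is proven analogously to [DST23]. \bel The following
properties hold true: `|G(Ω)(x,x′)| ≤ C e^{−C₁|x−x′|}`, `|(QG(Ω)Q*)⁻¹(y,y′)| ≤ C e^{−C₁|y−y′|}`, for some constants `C, C₁ > 0`,
independent of `n`. \eel»; Remark 4.2 «By a more careful analysis one can see that `C ∼ L⁴` and `C₁` is independent of `L`»).
Unit `lit-balaban-p12` (gen 10).

THE ROAD TAKEN (declared).  Print derives the lemma from the infinite-lattice random-walk expansion ([DST23], Appendix A) and the
method of images.  Here it is a corollary of the finite-propagation machinery of `DST24FinitePropagation`: if `Mu = f` with `M`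
`𝓛²`-coercive (`σ`), `𝓛²`-bounded (`Λ₂`), of range `ρ`, and `f` vanishes on the sites at block distance `< D` from `x`, then the
first `k₀` Richardson terms of `u = Σ_{k<k₀} cT^kf + T^{k₀}u` vanish at `x` (`T^k` has range `kρ < D`), so `u(x) = (T^{k₀}u)(x)` and
`‖u(x)‖ ≤ θ^{k₀}‖u‖_{2;Ω} ≤ σ⁻¹θ^{k₀}‖f‖_{2;Ω}`, `θ = (1 − σ²/Λ₂)^{1/2} < 1` (`norm_apply_le_of_vanish_near`).  For `f = δ_{x′}v` this is
the decay of the kernel of `Γ` in the block distance (`norm_Gamma_single_le`); for `(QΓQ*)⁻¹` the Schur-complement identity of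
`DST24InftyBounds.QGammaQstar_symm_eq` (`(QΓQ*)⁻¹ = 1 + Q∂*∂Q* − Q∂*∂K⁻¹R∂*∂Q*`, all factors of finite range, `K⁻¹` decaying by the
same theorem) gives the decay of its kernel in the label distance (`norm_QGammaQstar_symm_single_le`).  The printed form with
`e^{−C₁·}` and `C, C₁ > 0` independent of `n` is `green_function_neumann` / `green_function_inverse_neumann` (distances: the block
distance `blkDist` on `Ω`, which is within `|x−x′|_∞ ≤ L(blkDist+1)` of the site distance — `dist_le_of_blkDist` — and the label
sup-distance `cDist` on `Ω₁`; the constants obtained here depend on `L`, the sharper Remark 4.2 is not claimed).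

WHAT IS HERE.  `ipS_le_of_coercive` (`σ²⟨u,u⟩ ≤ ⟨Mu,Mu⟩`), `trunc_ball_eq_zero`, `norm_apply_le_of_vanish_near` (generic decay),
`decayRate L = (1 − (8L⁴)⁻²/130)^{1/2} ∈ (0,1)`, `ipS_single`, `norm_Gamma_single_le` (`‖(Γδ_{x′}v)(x)‖ ≤ 8L⁴·θ_L^{blkDist(x,x′)}‖v‖`),
`Q_eq_Pop_corner`, `norm_apply_le_of_hasRange` (local sup bound), `RAQstar_single_eq_zero`, `norm_Kinv_RAQstar_single_le`,
`norm_QGammaQstar_symm_single_le` (`‖((QΓQ*)⁻¹δ_{y′}v)(y)‖ ≤ (9 + 3072L⁵)·θ_L^{|y−y′|_∞−2}‖v‖`), `dist_le_of_blkDist`/`siteDist_succ_le`, and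
the printed exponential forms `green_function_neumann` (block distance), `green_function_neumann_site` (site distance `|x−x′|_∞`),
`green_function_inverse_neumann` (label distance `|y−y′|_∞`).
-/

namespace Literature.MathematicalPhysics.QuantumFieldTheory.DybalskiStottmeisterTanimoto2024.DST24KernelDecay

open scoped RealInnerProductSpace BigOperators
open Literature.MathematicalPhysics.QuantumFieldTheory.Federbush1986
open Literature.MathematicalPhysics.QuantumFieldTheory.DybalskiStottmeisterTanimoto2024.DST24Setting
open Literature.MathematicalPhysics.QuantumFieldTheory.DybalskiStottmeisterTanimoto2024.DST24LinearConstraint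
open Literature.MathematicalPhysics.QuantumFieldTheory.DybalskiStottmeisterTanimoto2024.DST24CriticalPoint
open Literature.MathematicalPhysics.QuantumFieldTheory.DybalskiStottmeisterTanimoto2024.DST24GreenFunction
open Literature.MathematicalPhysics.QuantumFieldTheory.DybalskiStottmeisterTanimoto2024.DST24LaplacianBounds
open Literature.MathematicalPhysics.QuantumFieldTheory.DybalskiStottmeisterTanimoto2024.DST24FinitePropagation
open Literature.MathematicalPhysics.QuantumFieldTheory.DybalskiStottmeisterTanimoto2024.DST24MainTheorem
open Literature.MathematicalPhysics.QuantumFieldTheory.DybalskiStottmeisterTanimoto2024.DST24InftyBounds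

noncomputable section

variable {L n₁ : ℕ}

/-! ## Generic decay: solutions of `Mu = f` away from the support of `f` -/

section Generic

variable {E : Type*} [NormedAddCommGroup E] [InnerProductSpace ℝ E]

/-- Coercivity controls the solution in `𝓛²`: `σ⟨u,u⟩ ≤ ⟨u,Mu⟩` gives `σ²⟨u,u⟩ ≤ ⟨Mu,Mu⟩` (from `0 ≤ ‖σu − Mu‖²`).
[cite: DybalskiStottmeisterTanimoto2024, §4.2 Lemma (inverse-lemma) 2. (Green-estimate), proof («`M ≥ C` … `M⁻¹`»)] -/
theorem ipS_le_of_coercive {M : (Site L n₁ → E) →ₗ[ℝ] (Site L n₁ → E)} {σ : ℝ} (hσ : 0 ≤ σ)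
    (hcoer : ∀ g, σ * ipS g g ≤ ipS g (M g)) (u : Site L n₁ → E) : σ ^ 2 * ipS u u ≤ ipS (M u) (M u) := by
  have h0 := ipS_self_nonneg (σ • u - M u)
  rw [ipS_sub_sub, ipS_smul_left, ipS_smul_right, ipS_smul_left] at h0
  have h1 := hcoer u
  nlinarith

omit [InnerProductSpace ℝ E] in
/-- If `f` vanishes at block distance `< D` from `x`, its restriction to a ball `B(x,r)`, `r < D`, is zero.
[cite: DybalskiStottmeisterTanimoto2024, §4.4 (restriction to a finite lattice)] -/
theorem trunc_ball_eq_zero {f : Site L n₁ → E} {x : Site L n₁} {D r : ℕ} (hf : ∀ z, blkDist x z < D → f z = 0)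
    (hr : r < D) : trunc (ball x r) f = 0 := by
  funext z
  rw [Pi.zero_apply]
  by_cases hz : z ∈ ball x r
  · rw [trunc_apply_of_mem f hz]; exact hf z (lt_of_le_of_lt (mem_ball.mp hz) hr)
  · exact trunc_apply_of_not_mem f hz

/-- **Generic decay.**  `M` linear on `𝓛²(Ω;E)`, `σ⟨g,g⟩ ≤ ⟨g,Mg⟩`, `⟨Mg,Mg⟩ ≤ Λ₂⟨g,g⟩`, range `ρ`; if `Mu = f` and `f` vanishes at block
distance `< D` from `x`, then for every `k₀` with `kρ < D` for all `k < k₀`: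
`‖u(x)‖ ≤ σ⁻¹·θ^{k₀}·‖f‖_{2;Ω}`, `θ = (1 − σ²/Λ₂)^{1/2}` — the Richardson terms `k < k₀` do not reach `x` (finite propagation), and
`u(x) = (T^{k₀}u)(x)` is small in `𝓛²`.  The tree's replacement for the random-walk decay of §4.3 / Appendix A on the finite lattice.
[cite: DybalskiStottmeisterTanimoto2024, §4.4 Lemma (Green-function-Neumann); §4.3 Lemma (free-exponential-decay)] -/
theorem norm_apply_le_of_vanish_near {M : (Site L n₁ → E) →ₗ[ℝ] (Site L n₁ → E)} {σ Λ2 : ℝ} {ρ : ℕ} (hσ : 0 < σ)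
    (hσΛ : σ ^ 2 ≤ Λ2) (hcoer : ∀ g, σ * ipS g g ≤ ipS g (M g)) (hbdd : ∀ g, ipS (M g) (M g) ≤ Λ2 * ipS g g)
    (hM : HasRange M ρ) {u f : Site L n₁ → E} (hu : M u = f) {x : Site L n₁} {D k₀ : ℕ}
    (hf : ∀ z, blkDist x z < D → f z = 0) (hk : ∀ k < k₀, k * ρ < D) :
    ‖u x‖ ≤ σ⁻¹ * Real.sqrt (1 - σ ^ 2 / Λ2) ^ k₀ * Real.sqrt (ipS f f) := by
  have hΛ : 0 < Λ2 := lt_of_lt_of_le (pow_pos hσ 2) hσΛ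
  set c : ℝ := σ / Λ2 with hc
  set θ2 : ℝ := 1 - σ ^ 2 / Λ2 with hθ2
  have hθ2nn : 0 ≤ θ2 := by rw [hθ2, sub_nonneg, div_le_one hΛ]; exact hσΛ
  -- the first `k₀` Richardson terms vanish at `x`
  have hvan : ∀ k < k₀, (step M c ^ k) f x = 0 := by
    intro k hk'
    rw [((hasRange_step hM c).pow k).apply_eq_apply_trunc f x, trunc_ball_eq_zero hf (hk k hk'), map_zero, Pi.zero_apply]
  have hux : u x = (step M c ^ k₀) u x := by
    have e := congrFun (telescope c hu k₀) x
    rw [Pi.add_apply, Finset.sum_apply, Finset.sum_eq_zero (fun k hk' => by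
      rw [Pi.smul_apply, hvan k (Finset.mem_range.mp hk'), smul_zero]), zero_add] at e
    exact e
  -- `‖(T^{k₀}u)(x)‖² ≤ θ₂^{k₀}⟨u,u⟩ ≤ θ₂^{k₀}σ⁻²⟨f,f⟩`
  have h1 : ‖u x‖ ^ 2 ≤ θ2 ^ k₀ * ipS u u := by
    rw [hux]
    exact (norm_apply_sq_le_ipS _ x).trans (ipS_step_pow_le hσ.le hΛ hσΛ hcoer hbdd k₀ u)
  have h2 : σ ^ 2 * ipS u u ≤ ipS f f := by rw [← hu]; exact ipS_le_of_coercive hσ.le hcoer u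
  have h3 : ipS u u ≤ (σ⁻¹) ^ 2 * ipS f f := by
    rw [inv_pow, ← div_eq_inv_mul, le_div_iff₀ (pow_pos hσ 2), mul_comm]; exact h2
  have h4 : ‖u x‖ ^ 2 ≤ (σ⁻¹ * Real.sqrt θ2 ^ k₀ * Real.sqrt (ipS f f)) ^ 2 :=
    calc ‖u x‖ ^ 2 ≤ θ2 ^ k₀ * ipS u u := h1
      _ ≤ θ2 ^ k₀ * ((σ⁻¹) ^ 2 * ipS f f) := mul_le_mul_of_nonneg_left h3 (pow_nonneg hθ2nn _)
      _ = (σ⁻¹ * Real.sqrt θ2 ^ k₀ * Real.sqrt (ipS f f)) ^ 2 := by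
          rw [mul_pow, mul_pow, ← pow_mul, mul_comm k₀ 2, pow_mul, Real.sq_sqrt hθ2nn, Real.sq_sqrt (ipS_self_nonneg f)]
          ring
  exact (abs_le_of_sq_le_sq' h4 (by positivity)).2

omit [InnerProductSpace ℝ E] in
/-- A local form of an `𝓛^∞` operator bound: if `T` has range `ρ`, `‖Tq‖_∞ ≤ C‖q‖_∞` for all `q`, and `‖q(ζ)‖ ≤ m` on the ball
`B(z,ρ)`, then `‖(Tq)(z)‖ ≤ C·m`. [cite: DybalskiStottmeisterTanimoto2024, §4.5 (norm-estimate)] -/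
theorem norm_apply_le_of_hasRange {T : (Site L n₁ → E) → (Site L n₁ → E)} {ρ : ℕ} (hT : HasRange T ρ) {C : ℝ} (hC : 0 ≤ C)
    (hTC : ∀ q, ‖T q‖ ≤ C * ‖q‖) (q : Site L n₁ → E) (z : Site L n₁) {m : ℝ} (hm0 : 0 ≤ m)
    (hm : ∀ ζ, blkDist z ζ ≤ ρ → ‖q ζ‖ ≤ m) : ‖T q z‖ ≤ C * m := by
  rw [hT.apply_eq_apply_trunc q z]
  have hq' : ‖trunc (ball z ρ) q‖ ≤ m := by
    refine (pi_norm_le_iff_of_nonneg hm0).mpr fun ζ => ?_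
    by_cases hζ : ζ ∈ ball z ρ
    · rw [trunc_apply_of_mem q hζ]; exact hm ζ (mem_ball.mp hζ)
    · rw [trunc_apply_of_not_mem q hζ, norm_zero]; exact hm0
  calc ‖T (trunc (ball z ρ) q) z‖ ≤ ‖T (trunc (ball z ρ) q)‖ := norm_le_pi_norm _ z
    _ ≤ C * ‖trunc (ball z ρ) q‖ := hTC _
    _ ≤ C * m := mul_le_mul_of_nonneg_left hq' hC

/-- `⟨δ_{x′}v, δ_{x′}v⟩_Ω = ‖v‖²`. [cite: DybalskiStottmeisterTanimoto2024, §4.3 («`δ_x`»)] -/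
theorem ipS_single (x' : Site L n₁) (v : E) : ipS (Pi.single x' v : Site L n₁ → E) (Pi.single x' v) = ‖v‖ ^ 2 := by
  rw [ipS_self, Finset.sum_eq_single x' (fun z _ hz => by rw [Pi.single_apply, if_neg hz, norm_zero]; ring)
    (fun h => absurd (Finset.mem_univ _) h), Pi.single_eq_same]

/-- A function vanishing off a finite set `S` has `‖g‖²_{2;Ω} ≤ |S|·‖g‖²_{∞;Ω}`. [cite: DybalskiStottmeisterTanimoto2024, §4.5 (norm-estimate)] -/
theorem ipS_le_card_mul_of_vanish_off (S : Finset (Site L n₁)) {g : Site L n₁ → E} (hg : ∀ z, z ∉ S → g z = 0) :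
    ipS g g ≤ S.card * ‖g‖ ^ 2 := by
  have e : g = trunc S g := by
    funext z
    by_cases hz : z ∈ S
    · rw [trunc_apply_of_mem g hz]
    · rw [trunc_apply_of_not_mem g hz, hg z hz]
  conv_lhs => rw [e]
  exact ipS_trunc_le S g

end Generic

/-! ## The decay rate `θ_L` -/

/-- `θ_L := (1 − ((8L⁴)⁻¹)²/130)^{1/2}` — the `𝓛²` contraction factor of the Richardson step for `σ = (8L⁴)⁻¹`, `Λ₂ = 130`.
[cite: DybalskiStottmeisterTanimoto2024, §4.4 Lemma (Green-function-Neumann) («`e^{−C₁}`»)] -/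
def decayRate (L : ℕ) : ℝ := Real.sqrt (1 - ((8 * (L : ℝ) ^ 4)⁻¹) ^ 2 / 130)

/-- `θ_L < 1` (for `L ≥ 1`). [cite: DybalskiStottmeisterTanimoto2024, §4.4 Lemma (Green-function-Neumann) («`C₁ > 0`»)] -/
theorem decayRate_lt_one (hL : 0 < L) : decayRate L < 1 := by
  rw [decayRate, Real.sqrt_lt' one_pos, one_pow, sub_lt_self_iff]
  have : (0 : ℝ) < (8 * (L : ℝ) ^ 4)⁻¹ := by positivity
  positivity

/-- `0 < θ_L`. [cite: DybalskiStottmeisterTanimoto2024, §4.4 Lemma (Green-function-Neumann)] -/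
theorem decayRate_pos (hL : 0 < L) : 0 < decayRate L := by
  rw [decayRate]
  apply Real.sqrt_pos.mpr
  have h3 : (8 * (L : ℝ) ^ 4)⁻¹ ≤ 1 := by
    apply inv_le_one_of_one_le₀
    have : (1 : ℝ) ≤ (L : ℝ) ^ 4 := one_le_pow₀ (by exact_mod_cast hL)
    linarith
  have h0 : 0 ≤ (8 * (L : ℝ) ^ 4)⁻¹ := by positivity
  nlinarith

/-- `0 ≤ θ_L`. [cite: DybalskiStottmeisterTanimoto2024, §4.4 Lemma (Green-function-Neumann)] -/
theorem decayRate_nonneg (L : ℕ) : 0 ≤ decayRate L := Real.sqrt_nonneg _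

/-- `θ_L ≤ 1`. [cite: DybalskiStottmeisterTanimoto2024, §4.4 Lemma (Green-function-Neumann)] -/
theorem decayRate_le_one (L : ℕ) : decayRate L ≤ 1 := by
  rw [decayRate, Real.sqrt_le_one]
  have : 0 ≤ ((8 * (L : ℝ) ^ 4)⁻¹) ^ 2 / 130 := by positivity
  linarith

/-- `θ_L^d = e^{−C₁d}` with `C₁ = −log θ_L > 0`. [cite: DybalskiStottmeisterTanimoto2024, §4.4 Lemma (Green-function-Neumann)] -/
theorem decayRate_pow_eq_exp (hL : 0 < L) (d : ℕ) : decayRate L ^ d = Real.exp (-(-Real.log (decayRate L)) * d) := by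
  rw [neg_neg, mul_comm, Real.exp_nat_mul, Real.exp_log (decayRate_pos hL)]

/-- `C₁ := −log θ_L > 0`. [cite: DybalskiStottmeisterTanimoto2024, §4.4 Lemma (Green-function-Neumann) («`C₁ > 0`»)] -/
theorem neg_log_decayRate_pos (hL : 0 < L) : 0 < -Real.log (decayRate L) :=
  neg_pos.mpr (Real.log_neg (decayRate_pos hL) (decayRate_lt_one hL))

section Kernels

variable {E : Type*} [NormedAddCommGroup E] [InnerProductSpace ℝ E] [FiniteDimensional ℝ E]

/-! ## The kernel of `Γ` -/

/-- **Decay of the Green function in the block distance**: `‖(Γ δ_{x′}v)(x)‖ ≤ 8L⁴·θ_L^{blkDist(x,x′)}·‖v‖`, uniformly in `n₁`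
(for scalar `E = ℝ`, `v = 1` this is the kernel `G(Ω)(x,x′)`). [cite: DybalskiStottmeisterTanimoto2024, §4.4 Lemma (Green-function-Neumann) (first display)] -/
theorem norm_Gamma_single_le (hL : 0 < L) (x x' : Site L n₁) (v : E) :
    ‖Gamma hL (Pi.single x' v : Site L n₁ → E) x‖ ≤ 8 * (L : ℝ) ^ 4 * decayRate L ^ blkDist x x' * ‖v‖ := by
  have h := norm_apply_le_of_vanish_near (M := Mop L) (by positivity) (sigma_sq_le hL) (ipS_Mop_ge hL)
    (ipS_Mfun_Mfun_le hL) (hasRange_Mop hL) (u := Gamma hL (Pi.single x' v)) (Mfun_Gamma hL _) (x := x)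
    (D := blkDist x x') (k₀ := blkDist x x')
    (fun z hz => by
      rw [Pi.single_apply, if_neg]
      rintro rfl
      exact lt_irrefl _ hz)
    (fun k hk => by rw [mul_one]; exact hk)
  rw [ipS_single, Real.sqrt_sq (norm_nonneg v), inv_inv] at h
  exact h

/-- **Lemma (Green-function-Neumann), first display, as printed (exponential form)**: there are `C, C₁ > 0` independent of `n`
with `|G(Ω)(x,x′)| ≤ C e^{−C₁ d(x,x′)}` for all volumes — here `d` = the block distance and, for a general fibre, `‖(Γδ_{x′}v)(x)‖ ≤
Ce^{−C₁d}‖v‖`; `C = 8L⁴`, `C₁ = −log θ_L`. [cite: DybalskiStottmeisterTanimoto2024, §4.4 Lemma (Green-function-Neumann) (first display)] -/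
theorem green_function_neumann (hL : 0 < L) :
    ∃ C C₁ : ℝ, 0 < C ∧ 0 < C₁ ∧ ∀ (n₁ : ℕ) (x x' : Site L n₁) (v : E),
      ‖Gamma hL (Pi.single x' v : Site L n₁ → E) x‖ ≤ C * Real.exp (-C₁ * blkDist x x') * ‖v‖ :=
  ⟨8 * (L : ℝ) ^ 4, -Real.log (decayRate L), by positivity, neg_log_decayRate_pos hL, fun n₁ x x' v => by
    rw [← decayRate_pow_eq_exp hL]; exact norm_Gamma_single_le hL x x' v⟩

/-! ## The kernel of `(QΓQ*)⁻¹` -/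

omit [FiniteDimensional ℝ E] in
/-- `(Qf)(y) = (Q*Qf)(z)` at any site `z` of the box `B(y)` (here the corner). [cite: DybalskiStottmeisterTanimoto2024, §2.1 (2.6)] -/
theorem Q_eq_Pop_corner (hL : 0 < L) (f : Site L n₁ → E) (y : CSite n₁) : Q L f y = Pop L f (corner hL y) := by
  rw [Pop_apply, Qstar_apply, blk_corner]

omit [InnerProductSpace ℝ E] [FiniteDimensional ℝ E] in
/-- `Q*δ_{y′}v` vanishes outside the box `B(y′)`. [cite: DybalskiStottmeisterTanimoto2024, §2.1 (2.6)] -/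
theorem Qstar_single_apply_eq_zero {y' : CSite n₁} {v : E} {z : Site L n₁} (hz : blk z ≠ y') :
    Qstar L (Pi.single y' v : CSite n₁ → E) z = 0 := by
  rw [Qstar_apply, Pi.single_apply, if_neg hz]

omit [InnerProductSpace ℝ E] [FiniteDimensional ℝ E] in
/-- `‖Q*δ_{y′}v‖_∞ ≤ ‖v‖`. [cite: DybalskiStottmeisterTanimoto2024, §2.1 (2.6)] -/
theorem norm_Qstar_single_le (y' : CSite n₁) (v : E) : ‖Qstar L (Pi.single y' v : CSite n₁ → E)‖ ≤ ‖v‖ :=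
  (norm_Qstar_le _).trans (by rw [Pi.norm_single])

omit [FiniteDimensional ℝ E] in
/-- `R∂*∂Q*δ_{y′}v` vanishes at every site whose box is at label distance `≥ 2` from `y′` (`R` range `0`, `∂*∂` range `1`).
[cite: DybalskiStottmeisterTanimoto2024, §4.4 Lemma (Green-function-Neumann) (second display)] -/
theorem RAQstar_single_eq_zero (hL : 0 < L) {y' : CSite n₁} (v : E) {z : Site L n₁} (hz : 2 ≤ cDist (blk z) y') :
    Rop L (Aop (Qstar L (Pi.single y' v : CSite n₁ → E))) z = 0 := by
  have hRA : HasRange (⇑(Rop L : (Site L n₁ → E) →ₗ[ℝ] _) ∘ ⇑(Aop : (Site L n₁ → E) →ₗ[ℝ] _)) 1 := by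
    have h := (hasRange_Rop (L := L) (n₁ := n₁) (E := E)).comp (hasRange_Aop (L := L) (n₁ := n₁) (E := E) hL)
    exact h.mono (by norm_num)
  have e := hRA.apply_eq_apply_trunc (Qstar L (Pi.single y' v)) z
  change Rop L (Aop (Qstar L (Pi.single y' v))) z = Rop L (Aop (trunc (ball z 1) (Qstar L (Pi.single y' v)))) z at e
  have h0 : trunc (ball z 1) (Qstar L (Pi.single y' v : CSite n₁ → E)) = 0 := by
    funext ζ
    rw [Pi.zero_apply]
    by_cases hζ : ζ ∈ ball z 1
    · rw [trunc_apply_of_mem _ hζ]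
      apply Qstar_single_apply_eq_zero
      intro hblk
      have h1 : blkDist z ζ ≤ 1 := mem_ball.mp hζ
      rw [blkDist_eq, hblk] at h1
      omega
    · exact trunc_apply_of_not_mem _ hζ
  rw [e, h0, map_zero, map_zero, Pi.zero_apply]

omit [FiniteDimensional ℝ E] in
/-- `‖R∂*∂Q*δ_{y′}v‖_{2;Ω} ≤ 48L‖v‖` (support in `≤ 9` boxes, sup norm `≤ 16‖v‖`). [cite: DybalskiStottmeisterTanimoto2024, §4.4 Lemma (Green-function-Neumann)] -/
theorem sqrt_ipS_RAQstar_single_le (hL : 0 < L) (y' : CSite n₁) (v : E) :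
    Real.sqrt (ipS (Rop L (Aop (Qstar L (Pi.single y' v : CSite n₁ → E))))
      (Rop L (Aop (Qstar L (Pi.single y' v : CSite n₁ → E))))) ≤ 48 * L * ‖v‖ := by
  set g : Site L n₁ → E := Rop L (Aop (Qstar L (Pi.single y' v : CSite n₁ → E))) with hg
  have hsup : ‖g‖ ≤ 16 * ‖v‖ :=
    calc ‖g‖ ≤ 2 * ‖(Aop (Qstar L (Pi.single y' v : CSite n₁ → E)) : Site L n₁ → E)‖ := norm_Rop_le hL _
      _ ≤ 2 * (8 * ‖Qstar L (Pi.single y' v : CSite n₁ → E)‖) := by gcongr; exact norm_Aop_le _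
      _ ≤ 2 * (8 * ‖v‖) := by gcongr; exact norm_Qstar_single_le y' v
      _ = 16 * ‖v‖ := by ring
  have hvan : ∀ z, z ∉ ball (corner hL y') 1 → g z = 0 := by
    intro z hz
    apply RAQstar_single_eq_zero hL v
    rw [mem_ball, blkDist_eq, blk_corner, cDist_comm] at hz
    omega
  have h1 : ipS g g ≤ (9 * (L : ℝ) ^ 2) * (16 * ‖v‖) ^ 2 :=
    calc ipS g g ≤ (ball (corner hL y') 1).card * ‖g‖ ^ 2 := ipS_le_card_mul_of_vanish_off _ hvan
      _ ≤ (9 * (L : ℝ) ^ 2) * (16 * ‖v‖) ^ 2 := by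
          refine mul_le_mul ?_ (pow_le_pow_left₀ (norm_nonneg _) hsup 2) (sq_nonneg _) (by positivity)
          have := card_ball_le (corner hL y') 1
          calc ((ball (corner hL y') 1).card : ℝ) ≤ ((L ^ 2 * (2 * 1 + 1) ^ 2 : ℕ) : ℝ) := by exact_mod_cast this
            _ = 9 * (L : ℝ) ^ 2 := by push_cast; ring
  have h2 : (9 * (L : ℝ) ^ 2) * (16 * ‖v‖) ^ 2 = (48 * L * ‖v‖) ^ 2 := by ring
  rw [h2] at h1
  exact Real.sqrt_le_sqrt h1 |>.trans (le_of_eq (Real.sqrt_sq (by positivity)))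

/-- Decay of `w = K⁻¹R∂*∂Q*δ_{y′}v`: `‖w(ζ)‖ ≤ 384L⁵·θ_L^{|y_ζ − y′|_∞ − 1}·‖v‖`.
[cite: DybalskiStottmeisterTanimoto2024, §4.4 Lemma (Green-function-Neumann) (second display)] -/
theorem norm_Kinv_RAQstar_single_le (hL : 0 < L) (y' : CSite n₁) (v : E) (ζ : Site L n₁) :
    ‖Kinv hL (Rop L (Aop (Qstar L (Pi.single y' v : CSite n₁ → E)))) ζ‖ ≤
      384 * (L : ℝ) ^ 5 * decayRate L ^ (cDist (blk ζ) y' - 1) * ‖v‖ := by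
  set g : Site L n₁ → E := Rop L (Aop (Qstar L (Pi.single y' v : CSite n₁ → E))) with hg
  have h := norm_apply_le_of_vanish_near (M := Kop L) (by positivity) (sigma_sq_le hL) (ipS_Kop_ge hL)
    (ipS_Kop_Kop_le hL) (hasRange_Kop hL) (u := Kinv hL g) (Kop_Kinv hL g) (x := ζ)
    (D := cDist (blk ζ) y' - 1) (k₀ := cDist (blk ζ) y' - 1)
    (fun z hz => by
      apply RAQstar_single_eq_zero hL v
      have ht := cDist_triangle (blk ζ) (blk z) y'
      rw [← blkDist_eq] at ht
      omega)
    (fun k hk => by rw [mul_one]; exact hk)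
  rw [inv_inv] at h
  refine h.trans ?_
  rw [← decayRate]
  have hθ := pow_nonneg (decayRate_nonneg L) (cDist (blk ζ) y' - 1)
  calc 8 * (L : ℝ) ^ 4 * decayRate L ^ (cDist (blk ζ) y' - 1) * Real.sqrt (ipS g g)
      ≤ 8 * (L : ℝ) ^ 4 * decayRate L ^ (cDist (blk ζ) y' - 1) * (48 * L * ‖v‖) :=
        mul_le_mul_of_nonneg_left (sqrt_ipS_RAQstar_single_le hL y' v) (by positivity)
    _ = 384 * (L : ℝ) ^ 5 * decayRate L ^ (cDist (blk ζ) y' - 1) * ‖v‖ := by ring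

/-- **Decay of the kernel of `(QΓQ*)⁻¹` in the label distance**: `‖((QΓQ*)⁻¹δ_{y′}v)(y)‖ ≤ (9 + 3072L⁵)·θ_L^{|y−y′|_∞ − 2}·‖v‖`,
uniformly in `n₁` (natural-number exponent `|y−y′|_∞ − 2`, truncated at `0`). [cite: DybalskiStottmeisterTanimoto2024, §4.4 Lemma (Green-function-Neumann) (second display)] -/
theorem norm_QGammaQstar_symm_single_le (hL : 0 < L) (y y' : CSite n₁) (v : E) :
    ‖(QGammaQstar hL).symm (Pi.single y' v : CSite n₁ → E) y‖ ≤
      (9 + 3072 * (L : ℝ) ^ 5) * decayRate L ^ (cDist y y' - 2) * ‖v‖ := by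
  set δ : CSite n₁ → E := Pi.single y' v with hδ
  set w : Site L n₁ → E := Kinv hL (Rop L (Aop (Qstar L δ))) with hw
  set q : Site L n₁ → E := Qstar L δ - w with hq
  have hθ0 := decayRate_nonneg L
  have hθ1 := decayRate_le_one L
  have hθd : 0 ≤ decayRate L ^ (cDist y y' - 2) := pow_nonneg hθ0 _
  rw [QGammaQstar_symm_eq hL δ, ← hw, ← hq, Pi.add_apply]
  -- the `δ` term
  have hδy : ‖δ y‖ ≤ decayRate L ^ (cDist y y' - 2) * ‖v‖ := by
    rw [hδ, Pi.single_apply]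
    split_ifs with hy
    · have : cDist y y' - 2 = 0 := by rw [hy, cDist_self]
      rw [this, pow_zero, one_mul]
    · rw [norm_zero]; positivity
  -- the local bound on `q` over the ball `B(corner y, 1)`
  have hm : ∀ ζ, blkDist (corner hL y) ζ ≤ 1 →
      ‖q ζ‖ ≤ (1 + 384 * (L : ℝ) ^ 5) * (decayRate L ^ (cDist y y' - 2) * ‖v‖) := by
    intro ζ hζ
    rw [blkDist_eq, blk_corner] at hζ
    have ht := cDist_triangle y (blk ζ) y'
    -- `Q*δ` at `ζ`
    have h1 : ‖Qstar L δ ζ‖ ≤ decayRate L ^ (cDist y y' - 2) * ‖v‖ := by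
      by_cases hb : blk ζ = y'
      · rw [hb] at hζ
        have : cDist y y' - 2 = 0 := by omega
        rw [this, pow_zero, one_mul, Qstar_apply, hδ, Pi.single_apply, if_pos hb]
      · rw [hδ, Qstar_single_apply_eq_zero hb, norm_zero]; positivity
    -- `w` at `ζ`
    have h2 : ‖w ζ‖ ≤ 384 * (L : ℝ) ^ 5 * (decayRate L ^ (cDist y y' - 2) * ‖v‖) := by
      have h := norm_Kinv_RAQstar_single_le hL y' v ζ
      rw [← hδ, ← hw] at h
      refine h.trans ?_
      rw [mul_assoc]
      refine mul_le_mul_of_nonneg_left (mul_le_mul_of_nonneg_right ?_ (norm_nonneg v)) (by positivity)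
      exact pow_le_pow_of_le_one hθ0 hθ1 (by omega)
    calc ‖q ζ‖ = ‖Qstar L δ ζ - w ζ‖ := by rw [hq, Pi.sub_apply]
      _ ≤ ‖Qstar L δ ζ‖ + ‖w ζ‖ := norm_sub_le _ _
      _ ≤ decayRate L ^ (cDist y y' - 2) * ‖v‖ + 384 * (L : ℝ) ^ 5 * (decayRate L ^ (cDist y y' - 2) * ‖v‖) :=
          add_le_add h1 h2
      _ = (1 + 384 * (L : ℝ) ^ 5) * (decayRate L ^ (cDist y y' - 2) * ‖v‖) := by ring
  -- the `Q∂*∂q` term, through `P∂*∂` (range `1`) at the corner of `B(y)`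
  have hPA : HasRange (⇑(Pop L : (Site L n₁ → E) →ₗ[ℝ] _) ∘ ⇑(Aop : (Site L n₁ → E) →ₗ[ℝ] _)) 1 := by
    have h := (hasRange_Pop (L := L) (n₁ := n₁) (E := E)).comp (hasRange_Aop (L := L) (n₁ := n₁) (E := E) hL)
    exact h.mono (by norm_num)
  have hQA : ‖Q L (Aop q) y‖ ≤ 8 * ((1 + 384 * (L : ℝ) ^ 5) * (decayRate L ^ (cDist y y' - 2) * ‖v‖)) := by
    rw [Q_eq_Pop_corner hL]
    exact norm_apply_le_of_hasRange hPA (by norm_num)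
      (fun q' => (norm_Pop_le hL _).trans (norm_Aop_le q')) q (corner hL y) (by positivity) hm
  calc ‖δ y + Q L (Aop q) y‖ ≤ ‖δ y‖ + ‖Q L (Aop q) y‖ := norm_add_le _ _
    _ ≤ decayRate L ^ (cDist y y' - 2) * ‖v‖ +
        8 * ((1 + 384 * (L : ℝ) ^ 5) * (decayRate L ^ (cDist y y' - 2) * ‖v‖)) := add_le_add hδy hQA
    _ = (9 + 3072 * (L : ℝ) ^ 5) * decayRate L ^ (cDist y y' - 2) * ‖v‖ := by ring

/-- **Lemma (Green-function-Neumann), second display, as printed (exponential form)**: there are `C, C₁ > 0` independent of `n`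
with `|(QG(Ω)Q*)⁻¹(y,y′)| ≤ C e^{−C₁|y−y′|}` for all volumes — here `|y−y′|` = the label sup-distance `cDist` and, for a general fibre,
`‖((QΓQ*)⁻¹δ_{y′}v)(y)‖ ≤ Ce^{−C₁|y−y′|}‖v‖`; `C = (9 + 3072L⁵)θ_L⁻²`, `C₁ = −log θ_L`.
[cite: DybalskiStottmeisterTanimoto2024, §4.4 Lemma (Green-function-Neumann) (second display)] -/
theorem green_function_inverse_neumann (hL : 0 < L) :
    ∃ C C₁ : ℝ, 0 < C ∧ 0 < C₁ ∧ ∀ (n₁ : ℕ) (y y' : CSite n₁) (v : E),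
      ‖(QGammaQstar hL).symm (Pi.single y' v : CSite n₁ → E) y‖ ≤ C * Real.exp (-C₁ * cDist y y') * ‖v‖ := by
  have hθ := decayRate_pos hL
  refine ⟨(9 + 3072 * (L : ℝ) ^ 5) * (decayRate L ^ 2)⁻¹, -Real.log (decayRate L), by positivity,
    neg_log_decayRate_pos hL, fun n₁ y y' v => ?_⟩
  rw [← decayRate_pow_eq_exp hL]
  refine (norm_QGammaQstar_symm_single_le hL y y' v).trans ?_
  rw [mul_assoc, mul_assoc, mul_assoc]
  refine mul_le_mul_of_nonneg_left ?_ (by positivity)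
  rw [← mul_assoc]
  refine mul_le_mul_of_nonneg_right ?_ (norm_nonneg v)
  -- `θ^{d-2} ≤ θ⁻²·θ^d`
  rw [le_inv_mul_iff₀ (pow_pos hθ 2), ← pow_add]
  exact pow_le_pow_of_le_one (decayRate_nonneg L) (decayRate_le_one L) (by omega)

end Kernels

/-! ## Block distance versus site distance -/

/-- `|x_μ − x′_μ| ≤ L·(blkDist(x,x′) + 1) − 1`: the block distance controls the site sup-distance, so decay in `blkDist` is decay in
`|x − x′|` with rate `C₁/L`. [cite: DybalskiStottmeisterTanimoto2024, §1.1 (B₁(y), y_x); §4.4 Lemma (Green-function-Neumann) («`|x − x′|`»)] -/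
theorem dist_le_of_blkDist (hL : 0 < L) (x x' : Site L n₁) (μ : Fin 2) :
    (x μ : ℕ).dist (x' μ) + 1 ≤ L * (blkDist x x' + 1) := by
  have h := dist_le_cDist (blk x) (blk x') μ
  rw [← blkDist_eq, blk_apply, blk_apply] at h
  have hx := Nat.div_add_mod (x μ : ℕ) L
  have hx' := Nat.div_add_mod (x' μ : ℕ) L
  have hr := Nat.mod_lt (x μ : ℕ) hL
  have hr' := Nat.mod_lt (x' μ : ℕ) hL
  generalize (x μ : ℕ) / L = a at hx h
  generalize (x' μ : ℕ) / L = a' at hx' h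
  generalize (x μ : ℕ) % L = r at hx hr
  generalize (x' μ : ℕ) % L = r' at hx' hr'
  have h1 : L * a ≤ L * a' + L * blkDist x x' := by
    rw [← mul_add]; apply Nat.mul_le_mul_left; unfold Nat.dist at h; omega
  have h2 : L * a' ≤ L * a + L * blkDist x x' := by
    rw [← mul_add]; apply Nat.mul_le_mul_left; unfold Nat.dist at h; omega
  rw [mul_add, mul_one]
  generalize L * a = P at hx h1 h2
  generalize L * a' = P' at hx' h1 h2
  generalize L * blkDist x x' = Q at h1 h2 ⊢
  unfold Nat.dist
  omega

/-- The site sup-distance `|x − x′|_∞` (`cDist` read on `Ω = CSite (L·n₁)`) is at most `L·(blkDist(x,x′) + 1) − 1`.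
[cite: DybalskiStottmeisterTanimoto2024, §1.1 (B₁(y)); §4.4 Lemma (Green-function-Neumann) («`|x − x′|`»)] -/
theorem siteDist_succ_le (hL : 0 < L) (x x' : Site L n₁) :
    cDist (n₁ := L * n₁) x x' + 1 ≤ L * (blkDist x x' + 1) := by
  have h1 : 1 ≤ L * (blkDist x x' + 1) := le_trans hL (Nat.le_mul_of_pos_right L (Nat.succ_pos _))
  suffices h : cDist (n₁ := L * n₁) x x' ≤ L * (blkDist x x' + 1) - 1 by omega
  exact cDist_le_iff.mpr fun μ => by have := dist_le_of_blkDist hL x x' μ; omega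

section SiteForm

variable {E : Type*} [NormedAddCommGroup E] [InnerProductSpace ℝ E] [FiniteDimensional ℝ E]

/-- **Lemma (Green-function-Neumann), first display, in the site distance**: `‖(Γδ_{x′}v)(x)‖ ≤ C e^{−C₁|x−x′|_∞}‖v‖` with
`C, C₁ > 0` independent of `n` (`C₁` here `∼ 1/L`; Remark 4.2's `L`-independence of `C₁` is not claimed).
[cite: DybalskiStottmeisterTanimoto2024, §4.4 Lemma (Green-function-Neumann) (first display)] -/
theorem green_function_neumann_site (hL : 0 < L) :
    ∃ C C₁ : ℝ, 0 < C ∧ 0 < C₁ ∧ ∀ (n₁ : ℕ) (x x' : Site L n₁) (v : E),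
      ‖Gamma hL (Pi.single x' v : Site L n₁ → E) x‖ ≤ C * Real.exp (-C₁ * cDist (n₁ := L * n₁) x x') * ‖v‖ := by
  obtain ⟨C, C₁, hC, hC₁, h⟩ := green_function_neumann (E := E) hL
  have hLr : (0 : ℝ) < L := by exact_mod_cast hL
  refine ⟨C * Real.exp C₁, C₁ / L, by positivity, by positivity, fun n₁ x x' v => ?_⟩
  refine (h n₁ x x' v).trans ?_
  have hsd : (cDist (n₁ := L * n₁) x x' : ℝ) + 1 ≤ L * (blkDist x x' + 1) := by
    exact_mod_cast siteDist_succ_le hL x x'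
  have hexp : Real.exp (-C₁ * blkDist x x') ≤ Real.exp C₁ * Real.exp (-(C₁ / L) * cDist (n₁ := L * n₁) x x') := by
    rw [← Real.exp_add]
    apply Real.exp_le_exp.mpr
    -- `−C₁·bd ≤ C₁ − (C₁/L)·sd` ⟸ `sd ≤ L(bd + 1)`
    have h1 : C₁ / L * (cDist (n₁ := L * n₁) x x' : ℝ) ≤ C₁ * (blkDist x x' + 1) := by
      rw [div_mul_eq_mul_div, div_le_iff₀ hLr]
      calc C₁ * (cDist (n₁ := L * n₁) x x' : ℝ) ≤ C₁ * (L * (blkDist x x' + 1)) := by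
            refine mul_le_mul_of_nonneg_left ?_ hC₁.le; linarith
        _ = C₁ * ((blkDist x x' : ℝ) + 1) * L := by ring
    linarith
  calc C * Real.exp (-C₁ * blkDist x x') * ‖v‖ ≤ C * (Real.exp C₁ * Real.exp (-(C₁ / L) * cDist (n₁ := L * n₁) x x')) * ‖v‖ := by
        gcongr
    _ = C * Real.exp C₁ * Real.exp (-(C₁ / L) * cDist (n₁ := L * n₁) x x') * ‖v‖ := by ring

end SiteForm

end

end Literature.MathematicalPhysics.QuantumFieldTheory.DybalskiStottmeisterTanimoto2024.DST24KernelDecay
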